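import Literature.Barriers.CriticalPhenomena.LaceExpansionXSpacePsiBounds
import Literature.Barriers.CriticalPhenomena.LaceExpansionXSpaceKernelNorms
import HarnessLib

/-!
# The Hara–Slade diagrams at `p_c` as chains of pair kernels: `Ψ^{(N)} = Ψ^{(0)}(B₁B₂)^N`,
# `Ψ̄^{(N)} = (B₂B₁)^N Ψ^{(0)}`, the diagram of `Π^{(N+1)}` as `Ψ^{(0)} B₁B₂⋯B₁B₂B₁ A₃(·,x)` — PROVED

Barrier catalogue `Literature/Barriers/CriticalPhenomena/` (D-0021). This file instantiates the
generic pair-kernel algebra of `LaceExpansionXSpaceKernelNorms.lean` (norms `‖·‖_{∞→∞}`,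
`‖·‖_{1→1}`, `‖·‖_mix`, chains, the three-factor estimate (7.5.21)) on the explicit lattice sums
of `LaceExpansionXSpaceLemma16.lean` / `LaceExpansionXSpacePsiBounds.lean`
(Heydenreich–van der Hofstad (7.4.2)–(7.4.4), (7.4.10), (7.5.5)–(7.5.6), (7.5.20)), as the
starting point of the weighted `N`-loop estimate (Hara 2008, §3.4; `Hara2008_weightedNLoopBoundPc`):

* the kernels `kB1`, `kB2` (`B₁`, `B₂` on pairs), the start vector `kPsiZero` (`Ψ^{(0)}`) and the
  end vector `kA3end` (`A₃(z,t,x)`); their translation invariance (`pkTI_kB1`, `pkTI_kB2`,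
  `pjTI_kA3end`, from `percB1_eq`, `percB2_eq`, `percA3_eq`);
* PROVED identities: `percPsi_succ_eq_pkVmul` ((7.5.6)), `percPsi_eq_pkChainL`
  (`Ψ^{(N)} = Ψ^{(0)} (B₁B₂)^N`), `percPsiBar_eq_pkChainR` (`Ψ̄^{(N)} = (B₂B₁)^N Ψ^{(0)}`, (7.5.20)),
  `piNDiagramPc_succ_eq_tsum_chain` and `piNDiagramPc_succ_eq_tsum_fineChain` (the diagram
  (7.4.10) of `Π^{(N+1)}` as the chain over the block list `(B₁B₂)^N, B₁`, resp. over the fine list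
  `kFine d N = B₁, B₂, …, B₁, B₂, B₁`), `pkChainL_replicate_pair` (regrouping);
* PROVED norm identities: `pkNormInf_kB1_kB2 = percB1B2Norm ≤ 2Δ̃_{p_c}Δ_{p_c}` ((7.5.12)),
  `pkNormOne_kB2_kB1 = percB2B1Norm ≤ 2Δ̃_{p_c}Δ_{p_c}` (Exercise 7.5), `tsum_kPsiZero`,
  `tsum_kA3end_zero` (`= Δ_{p_c}(0)`).

## References

* M. Heydenreich, R. van der Hofstad, *Progress in High-Dimensional Percolation and Random
  Graphs*, Springer 2017: (7.4.2)–(7.4.4), (7.4.10), (7.5.5)–(7.5.6), (7.5.11)–(7.5.12), (7.5.18),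
  (7.5.20), Exercise 7.5.
* T. Hara, Ann. Probab. 36 (2008) 530–593 (arXiv:math-ph/0504021): §3.4.
-/

noncomputable section

namespace Literature.Barriers.CriticalPhenomena

open _root_.MeasureTheory _root_.Filter Literature.Probability.LatticeModels
  Literature.Probability.Percolation

open scoped ENNReal

/-! ### The Hara–Slade diagrams as chains of pair kernels -/

section Chains

variable {d : ℕ}

/-- `B₁` as a kernel on pairs: `kB1((s,t),(u,v)) = B₁(s,t,u,v)`. [cite: HeydenreichVanDerHofstad2017, (7.4.3)] -/
def kB1 (d : ℕ) (p q : Site d × Site d) : ℝ≥0∞ := percB1 d p.1 p.2 q.1 q.2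

/-- `B₂` as a kernel on pairs: `kB2((u,v),(s,t)) = B₂(u,v,s,t)`. [cite: HeydenreichVanDerHofstad2017, (7.4.4)] -/
def kB2 (d : ℕ) (p q : Site d × Site d) : ℝ≥0∞ := percB2 d p.1 p.2 q.1 q.2

/-- The start vector `Ψ^{(0)}(w,u) = A₃(0,u,w)`. [cite: HeydenreichVanDerHofstad2017, (7.5.5)] -/
def kPsiZero (d : ℕ) (p : Site d × Site d) : ℝ≥0∞ := percPsi d 0 p.1 p.2

/-- The end vector `A₃(z,t,x)` (depending on the endpoint `x`). [cite: HeydenreichVanDerHofstad2017, (7.4.10)] -/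
def kA3end (d : ℕ) (p : Site d × Site d) (x : Site d) : ℝ≥0∞ := percA3 d p.1 p.2 x

/-- `B₁` is translation invariant. [folklore] -/
theorem pkTI_kB1 : PkTI (kB1 d) := by
  intro c p q
  simp only [kB1, percB1_eq, add_sub_add_right_eq_sub]

/-- `B₂⁽¹⁾` is translation invariant. [folklore] -/
theorem percB2one_add (c : Site d) (u v s t : Site d) :
    percB2one d (u + c) (v + c) (s + c) (t + c) = percB2one d u v s t := by
  simp only [percB2one, add_sub_add_right_eq_sub]

/-- `B₂⁽²⁾` is translation invariant. [folklore] -/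
theorem percB2two_add (c : Site d) (u v s t : Site d) :
    percB2two d (u + c) (v + c) (s + c) (t + c) = percB2two d u v s t := by
  unfold percB2two
  by_cases h : v = s
  · rw [if_pos (show v + c = s + c by rw [h]), if_pos h, tsum_shift _ c]
    refine tsum_congr fun a => ?_
    simp only [add_sub_add_right_eq_sub]
  · rw [if_neg (fun h' => h (add_right_cancel h')), if_neg h]

/-- `B₂` is translation invariant. [folklore] -/
theorem pkTI_kB2 : PkTI (kB2 d) := by
  intro c p q
  simp only [kB2, percB2_eq, percB2one_add, percB2two_add]

/-- `A₃(z,t,x)` is jointly translation invariant. [folklore] -/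
theorem pjTI_kA3end : PjTI (kA3end d) := by
  intro c p x
  simp only [kA3end, percA3_eq, add_sub_add_right_eq_sub]

/-- The recursion (7.5.6) as a vector–kernel product: `Ψ^{(N+1)} = Ψ^{(N)} (B₁B₂)`.
[cite: HeydenreichVanDerHofstad2017, (7.5.6)] -/
theorem percPsi_succ_eq_pkVmul (n : ℕ) :
    (fun p : Site d × Site d => percPsi d (n + 1) p.1 p.2) =
      pkVmul (fun p => percPsi d n p.1 p.2) (pkMul (kB1 d) (kB2 d)) := by
  funext p
  show (∑' q : Site d × Site d × Site d × Site d, percPsi d n q.1 q.2.1 *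
      percB1 d q.1 q.2.1 q.2.2.1 q.2.2.2 * percB2 d q.2.2.1 q.2.2.2 p.1 p.2) = _
  rw [tsum_quad_eq_tsum_pair_pair]
  refine tsum_congr fun p₀ => ?_
  rw [pkMul, ← ENNReal.tsum_mul_left]
  refine tsum_congr fun zt => ?_
  simp only [kB1, kB2, mul_assoc]

/-- **`Ψ^{(N)}` is the left chain `Ψ^{(0)} (B₁B₂)^N`.** [cite: HeydenreichVanDerHofstad2017, (7.5.5)–(7.5.6)] -/
theorem percPsi_eq_pkChainL (n : ℕ) :
    (fun p : Site d × Site d => percPsi d n p.1 p.2) =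
      pkChainL (kPsiZero d) (List.replicate n (pkMul (kB1 d) (kB2 d))) := by
  induction n with
  | zero => rfl
  | succ n ih => rw [List.replicate_succ', pkChainL_append, ← ih, percPsi_succ_eq_pkVmul]; rfl

/-- **`Ψ̄^{(N)}` is the right chain `(B₂B₁)^N Ψ^{(0)}`.** [cite: HeydenreichVanDerHofstad2017, (7.5.20)] -/
theorem percPsiBar_eq_pkChainR (m : ℕ) :
    (fun p : Site d × Site d => percPsiBar d m p.1 p.2) =
      pkChainR (List.replicate m (pkMul (kB2 d) (kB1 d))) (kPsiZero d) := by
  induction m with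
  | zero => rfl
  | succ m ih =>
    rw [List.replicate_succ, pkChainR_cons, ← ih]
    funext p
    show (∑' q : Site d × Site d × Site d × Site d, percB2 d p.1 p.2 q.1 q.2.1 *
        percB1 d q.1 q.2.1 q.2.2.1 q.2.2.2 * percPsiBar d m q.2.2.1 q.2.2.2) = _
    rw [tsum_quad_eq_tsum_pair_pair, ENNReal.tsum_comm]
    refine tsum_congr fun p' => ?_
    rw [pkMul, ← ENNReal.tsum_mul_right]
    rfl

/-- **The diagram bounding `Π^{(N+1)}` is a chain**: `[diagram](x) = Σ_p (Ψ^{(0)} (B₁B₂)^N B₁)(p) A₃(p, x)`.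
[cite: HeydenreichVanDerHofstad2017, (7.4.10)] -/
theorem piNDiagramPc_succ_eq_tsum_chain (n : ℕ) (x : Site d) :
    piNDiagramPc d (n + 1) x = ∑' p, pkChainL (kPsiZero d)
      (List.replicate n (pkMul (kB1 d) (kB2 d)) ++ [kB1 d]) p * kA3end d p x := by
  rw [pkChainL_append, ← percPsi_eq_pkChainL, pkChainL_cons, pkChainL_nil, tsum_pkVmul_mul]
  show (∑' q : Site d × Site d × Site d × Site d, percPsi d n q.1 q.2.1 *
      percB1 d q.1 q.2.1 q.2.2.1 q.2.2.2 * percA3 d q.2.2.1 q.2.2.2 x) = _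
  rw [tsum_quad_eq_tsum_pair_pair]
  refine tsum_congr fun p₀ => ?_
  rw [pkKvec, ← ENNReal.tsum_mul_left]
  refine tsum_congr fun zt => ?_
  simp only [kB1, kA3end, mul_assoc]

/-- A left chain over the alternating list `[X, Y, X, Y, …] ++ Z` regrouped into blocks `XY`. [folklore] -/
theorem pkChainL_replicate_pair {α : Type*} (v : α × α → ℝ≥0∞) (X Y : α × α → α × α → ℝ≥0∞)
    (n : ℕ) (Zs : List (α × α → α × α → ℝ≥0∞)) :
    pkChainL v ((List.replicate n [X, Y]).flatten ++ Zs) = pkChainL v (List.replicate n (pkMul X Y) ++ Zs) := by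
  induction n generalizing v with
  | zero => rfl
  | succ n ih =>
    rw [List.replicate_succ, List.flatten_cons, List.replicate_succ]
    show pkChainL v (X :: Y :: ((List.replicate n [X, Y]).flatten ++ Zs)) =
      pkChainL v (pkMul X Y :: (List.replicate n (pkMul X Y) ++ Zs))
    rw [pkChainL_cons_cons, pkChainL_cons, pkChainL_cons, ih]

/-- The fine list of kernels `B₁, B₂, B₁, B₂, …, B₁` (`N` blocks `B₁B₂`, then the last `B₁`) of the
diagram bounding `Π^{(N+1)}`. [cite: HeydenreichVanDerHofstad2017, (7.4.10)] -/
def kFine (d : ℕ) (n : ℕ) : List (Site d × Site d → Site d × Site d → ℝ≥0∞) :=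
  (List.replicate n [kB1 d, kB2 d]).flatten ++ [kB1 d]

/-- **The diagram bounding `Π^{(N+1)}` as the fine chain** `Σ_p (Ψ^{(0)} B₁ B₂ ⋯ B₁ B₂ B₁)(p) A₃(p, x)`.
[cite: HeydenreichVanDerHofstad2017, (7.4.10)] -/
theorem piNDiagramPc_succ_eq_tsum_fineChain (n : ℕ) (x : Site d) :
    piNDiagramPc d (n + 1) x = ∑' p, pkChainL (kPsiZero d) (kFine d n) p * kA3end d p x := by
  rw [kFine, pkChainL_replicate_pair]
  exact piNDiagramPc_succ_eq_tsum_chain n x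

/-- The `ℓ^∞ → ℓ^∞` norm of the block `B₁B₂` is the quantity (7.5.12).
[cite: HeydenreichVanDerHofstad2017, (7.5.12)] -/
theorem pkNormInf_kB1_kB2 : pkNormInf (pkMul (kB1 d) (kB2 d)) = percB1B2Norm d := by
  refine iSup_congr fun p => ?_
  rw [percB1B2Sum_eq]
  calc ∑' p', pkMul (kB1 d) (kB2 d) p p' = ∑' zt, ∑' p', kB1 d p zt * kB2 d zt p' := ENNReal.tsum_comm
    _ = _ := tsum_congr fun zt => ENNReal.tsum_mul_left

/-- The `ℓ¹ → ℓ¹` norm of the block `B₂B₁` is the reversed quantity of Exercise 7.5.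
[cite: HeydenreichVanDerHofstad2017, Exercise 7.5] -/
theorem pkNormOne_kB2_kB1 : pkNormOne (pkMul (kB2 d) (kB1 d)) = percB2B1Norm d := by
  refine iSup_congr fun p' => ?_
  rw [percB2B1Sum_eq]
  calc ∑' p, pkMul (kB2 d) (kB1 d) p p' = ∑' st, ∑' p, kB2 d p st * kB1 d st p' := ENNReal.tsum_comm
    _ = _ := tsum_congr fun st => ENNReal.tsum_mul_right

/-- `‖B₁B₂‖_{∞→∞} ≤ 2 Δ̃_{p_c} Δ_{p_c}`. [cite: HeydenreichVanDerHofstad2017, (7.5.12)] -/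
theorem pkNormInf_kB1_kB2_le : pkNormInf (pkMul (kB1 d) (kB2 d)) ≤ 2 * percTriTildeBar d * percTriBar d :=
  pkNormInf_kB1_kB2.trans_le percB1B2Norm_le

/-- `‖B₂B₁‖_{1→1} ≤ 2 Δ̃_{p_c} Δ_{p_c}`. [cite: HeydenreichVanDerHofstad2017, Exercise 7.5] -/
theorem pkNormOne_kB2_kB1_le : pkNormOne (pkMul (kB2 d) (kB1 d)) ≤ 2 * percTriTildeBar d * percTriBar d :=
  pkNormOne_kB2_kB1.trans_le percB2B1Norm_le

/-- `Σ_p Ψ^{(0)}(p) = Δ_{p_c}(0)`. [cite: HeydenreichVanDerHofstad2017, (7.5.10)] -/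
theorem tsum_kPsiZero : ∑' p, kPsiZero d p = percTri d 0 := tsum_percPsi_zero

/-- `Σ_{z,t} A₃(z,t,0) = Δ_{p_c}(0)` (the end vector anchored at the endpoint sums to the closed
triangle). [cite: HeydenreichVanDerHofstad2017, (7.5.7) and (7.5.10)] -/
theorem tsum_kA3end_zero : ∑' p, kA3end d p 0 = percTri d 0 := by
  rw [← tsum_percPsi_zero]
  refine tsum_congr fun p => ?_
  show percA3 d p.1 p.2 0 = percA3 d 0 p.2 p.1
  rw [percA3_eq, percA3_eq, zero_sub, zero_sub, sub_zero, sub_zero, tauPcE_neg, tauPcE_neg,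
    tauPcE_sub_comm p.2 p.1]
  ring

end Chains

end Literature.Barriers.CriticalPhenomena
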